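/-
Copyright (c) 2026 the pub-hodgecm-mathlib formalisation cell (harness21).  Prover seat hodgecm-mathlib-K2Liu-p11 (g2), Track B «K2-LIT»,
#184♮ = hLiu418 = `stmt-HodgeConjecture-24832`; organ S2, LEAD F0P6-plan (g14) RULING M-158g road (γ): the multi-place carrier, GENERIC LAYER (definition lane).
Mirrors ★ `K2LiuU22CompactPictureDefs` §3 (K2Liu-p10 (g4)) with an arbitrary variable type `σ` and an arbitrary localising polynomial `Δ`.
-/
import Mathlib.RingTheory.Localization.Away.Basic
import Mathlib.Algebra.MvPolynomial.PDeriv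
import Mathlib.RingTheory.Derivation.Basic
import Mathlib.Algebra.TrivSqZeroExt.Basic
import Mathlib.Data.Complex.Basic
import HarnessLib

/-!
# Crux `HLiu418`, road (γ): FORMAL PARTIAL DERIVATIVES AND EVALUATIONS ON A LOCALISED POLYNOMIAL RING `ℂ[X_σ][Δ⁻¹]`

Cell `hodgecm-mathlib`, crux item hLiu418 = `stmt-HodgeConjecture-24832` (helper lane `--supports`, count-neutral; DEFINITIONS + interface lemmas).

For a variable type `σ` and a polynomial `Δ ∈ ℂ[X_σ]`, on `𝒜_Δ := Localization.Away Δ`: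
* `pdLift Δ s`, `pdLiftAway Δ s` — the first-order (dual-number) lift of `∂_s = pderiv s` and its extension through the localisation;
* **`pdAway Δ s : Derivation ℂ 𝒜_Δ 𝒜_Δ`** — the unique extension of `pderiv s` (`pdAway_algebraMap`, `pdAway_X`);
* **`invAway Δ`** — `Δ⁻¹ ∈ 𝒜_Δ` (`algebraMap_mul_invAway`, `pdAway_invAway`);
* **`evalAway Δ x hx : 𝒜_Δ →ₐ[ℂ] ℂ`** — evaluation at a point `x : σ → ℂ` with `Δ(x) ≠ 0` (`evalAway_algebraMap`, `evalAway_X`, `evalAway_invAway`).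
The one-place ★ DEFS leaf is the case `σ = Fin 2 × Fin 2`, `Δ = detPoly`; the multi-place carrier of M-158g (`K2LiuU22MultiPlaceCarrierDefs`) is the case
`σ = (Fin 2 × Fin 2) × ι`, `Δ = ∏_w det_w`.
References: [KashiwaraVergne1978, §II.5]; [LeeZhu1998, §5 p. 5032].
HONEST LABEL: HC_CM is proved only modulo the 7 printed citations (2 remaining named inputs: hLiu418 = stmt-HodgeConjecture-24832,
h413 = stmt-HodgeConjecture-24833) until rung 0 closes; count-neutral helper, closes no socket.
-/

set_option autoImplicit false
set_option linter.dupNamespace false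

noncomputable section

open MvPolynomial

namespace Summit.HodgeConjecture.HodgeConjecture.Cruxes.HLiu418.K2LiuPolynomialLocalizationDerivationDefs

variable {σ : Type*} (Δ : MvPolynomial σ ℂ)

section Deriv

variable [DecidableEq σ]

/-! ## §1  The first-order lift and its extension through the localisation -/

/-- The first-order lift `P ↦ (P, ∂_s P)` of `ℂ[X_σ]` into the dual numbers over `𝒜_Δ`. [KashiwaraVergne1978, §II.5] -/
def pdLift (s : σ) : MvPolynomial σ ℂ →ₐ[ℂ] TrivSqZeroExt (Localization.Away Δ) (Localization.Away Δ) :=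
  MvPolynomial.aeval fun t => TrivSqZeroExt.inl (algebraMap (MvPolynomial σ ℂ) (Localization.Away Δ) (X t)) +
    (if t = s then TrivSqZeroExt.inr 1 else 0)

/-- The first component of the lift is the localisation map. [folklore] -/
theorem fst_pdLift (s : σ) (P : MvPolynomial σ ℂ) : (pdLift Δ s P).fst = algebraMap (MvPolynomial σ ℂ) (Localization.Away Δ) P := by
  have h : (TrivSqZeroExt.fstHom ℂ (Localization.Away Δ) (Localization.Away Δ)).comp (pdLift Δ s) =
      IsScalarTower.toAlgHom ℂ (MvPolynomial σ ℂ) (Localization.Away Δ) := by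
    refine MvPolynomial.algHom_ext fun t => ?_
    simp only [AlgHom.comp_apply, pdLift, MvPolynomial.aeval_X, IsScalarTower.toAlgHom_apply]
    split_ifs <;> simp [TrivSqZeroExt.fstHom]
  exact AlgHom.congr_fun h P

/-- The second component of the lift is `pderiv s`. [folklore] -/
theorem snd_pdLift (s : σ) (P : MvPolynomial σ ℂ) :
    (pdLift Δ s P).snd = algebraMap (MvPolynomial σ ℂ) (Localization.Away Δ) (pderiv s P) := by
  induction P using MvPolynomial.induction_on with
  | C c =>
    rw [pdLift, MvPolynomial.algHom_C, pderiv_C, map_zero]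
    rfl
  | add p q hp hq => rw [map_add, TrivSqZeroExt.snd_add, hp, hq, map_add, map_add]
  | mul_X p t hp =>
    have hX : (pdLift Δ s (X t)).snd = algebraMap (MvPolynomial σ ℂ) (Localization.Away Δ) (pderiv s (X t)) := by
      rw [pdLift, MvPolynomial.aeval_X, TrivSqZeroExt.snd_add, TrivSqZeroExt.snd_inl, zero_add, pderiv_X]
      split_ifs with h
      · subst h; simp [Pi.single_eq_same]
      · rw [Pi.single_eq_of_ne h, map_zero]; rfl
    rw [map_mul, TrivSqZeroExt.snd_mul, hp, fst_pdLift, fst_pdLift, hX, Derivation.leibniz]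
    simp only [smul_eq_mul, map_add, map_mul, MulOpposite.smul_eq_mul_unop, MulOpposite.unop_op]
    ring

/-- `Δ ↦ (Δ, ∂_s Δ)` is a unit of the dual numbers (its first component `Δ` is a unit of `𝒜_Δ`). [folklore] -/
theorem isUnit_pdLift_self (s : σ) : IsUnit (pdLift Δ s Δ) := by
  rw [TrivSqZeroExt.isUnit_iff_isUnit_fst, fst_pdLift]
  exact IsLocalization.Away.algebraMap_isUnit Δ

/-- The lift extended through the localisation: `𝒜_Δ → 𝒜_Δ[ε]`. [folklore] -/
def pdLiftAway (s : σ) : Localization.Away Δ →+* TrivSqZeroExt (Localization.Away Δ) (Localization.Away Δ) :=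
  IsLocalization.Away.lift Δ (g := (pdLift Δ s).toRingHom) (isUnit_pdLift_self Δ s)

/-- The extended lift on the image of a polynomial. [folklore] -/
theorem pdLiftAway_algebraMap (s : σ) (P : MvPolynomial σ ℂ) :
    pdLiftAway Δ s (algebraMap (MvPolynomial σ ℂ) (Localization.Away Δ) P) = pdLift Δ s P :=
  IsLocalization.Away.lift_eq Δ (isUnit_pdLift_self Δ s) P

/-- The first component of the extended lift is the identity. [folklore] -/
theorem fst_pdLiftAway (s : σ) (a : Localization.Away Δ) : (pdLiftAway Δ s a).fst = a := by
  have h : (TrivSqZeroExt.fstHom ℂ (Localization.Away Δ) (Localization.Away Δ)).toRingHom.comp (pdLiftAway Δ s) =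
      RingHom.id (Localization.Away Δ) := by
    refine IsLocalization.ringHom_ext (Submonoid.powers Δ) (RingHom.ext fun P => ?_)
    simp only [RingHom.comp_apply, RingHom.id_apply, pdLiftAway_algebraMap]
    exact fst_pdLift Δ s P
  exact RingHom.congr_fun h a

/-- The extended lift on scalars. [folklore] -/
theorem pdLiftAway_algebraMap_complex (s : σ) (c : ℂ) :
    pdLiftAway Δ s (algebraMap ℂ (Localization.Away Δ) c) = TrivSqZeroExt.inl (algebraMap ℂ (Localization.Away Δ) c) := by
  rw [IsScalarTower.algebraMap_apply ℂ (MvPolynomial σ ℂ) (Localization.Away Δ), pdLiftAway_algebraMap, MvPolynomial.algebraMap_eq, pdLift,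
    MvPolynomial.algHom_C]
  rfl

/-! ## §2  The formal partial derivative `∂_s` on `𝒜_Δ` -/

/-- **THE FORMAL PARTIAL `∂_s : 𝒜_Δ → 𝒜_Δ`** — a `ℂ`-derivation extending `pderiv s` (derivations extend uniquely through localisations). [KashiwaraVergne1978, §II.5] -/
def pdAway (s : σ) : Derivation ℂ (Localization.Away Δ) (Localization.Away Δ) where
  toFun a := (pdLiftAway Δ s a).snd
  map_add' a b := by
    show (pdLiftAway Δ s (a + b)).snd = (pdLiftAway Δ s a).snd + (pdLiftAway Δ s b).snd
    rw [map_add]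
    rfl
  map_smul' c a := by
    show (pdLiftAway Δ s (c • a)).snd = c • (pdLiftAway Δ s a).snd
    rw [Algebra.smul_def, map_mul, pdLiftAway_algebraMap_complex, TrivSqZeroExt.snd_mul, TrivSqZeroExt.fst_inl, TrivSqZeroExt.snd_inl, smul_zero, add_zero,
      smul_eq_mul, Algebra.smul_def]
  map_one_eq_zero' := by
    show (pdLiftAway Δ s 1).snd = 0
    rw [map_one]
    rfl
  leibniz' a b := by
    show (pdLiftAway Δ s (a * b)).snd = a • (pdLiftAway Δ s b).snd + b • (pdLiftAway Δ s a).snd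
    rw [map_mul, TrivSqZeroExt.snd_mul, fst_pdLiftAway, fst_pdLiftAway]
    simp only [MulOpposite.smul_eq_mul_unop, MulOpposite.unop_op, smul_eq_mul]
    ring

/-- unfolding. [folklore] -/
theorem pdAway_apply (s : σ) (a : Localization.Away Δ) : pdAway Δ s a = (pdLiftAway Δ s a).snd :=
  rfl

/-- **`∂_s` EXTENDS `pderiv s`** on the image of the polynomial ring. [KashiwaraVergne1978, §II.5] -/
theorem pdAway_algebraMap (s : σ) (P : MvPolynomial σ ℂ) :
    pdAway Δ s (algebraMap (MvPolynomial σ ℂ) (Localization.Away Δ) P) = algebraMap (MvPolynomial σ ℂ) (Localization.Away Δ) (pderiv s P) := by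
  rw [pdAway_apply, pdLiftAway_algebraMap, snd_pdLift]

/-- **`∂_s X_t = δ_{st}`**. [KashiwaraVergne1978, §II.5] -/
theorem pdAway_X (s t : σ) : pdAway Δ s (algebraMap (MvPolynomial σ ℂ) (Localization.Away Δ) (X t)) = if t = s then 1 else 0 := by
  rw [pdAway_algebraMap, pderiv_X]
  by_cases h : t = s
  · subst h; simp
  · rw [if_neg h, Pi.single_eq_of_ne h, map_zero]

end Deriv

/-! ## §3  The inverse of `Δ` and evaluation -/

/-- **`Δ⁻¹ ∈ 𝒜_Δ`**. [folklore] -/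
def invAway : Localization.Away Δ :=
  IsLocalization.Away.invSelf Δ

/-- `Δ · Δ⁻¹ = 1` in `𝒜_Δ`. [folklore] -/
theorem algebraMap_mul_invAway : algebraMap (MvPolynomial σ ℂ) (Localization.Away Δ) Δ * invAway Δ = 1 := by
  rw [invAway, IsLocalization.Away.mul_invSelf]

/-- **`∂_s Δ⁻¹ = −Δ⁻² · ∂_s Δ`** (Leibniz on `Δ · Δ⁻¹ = 1`). [folklore] -/
theorem pdAway_invAway [DecidableEq σ] (s : σ) :
    pdAway Δ s (invAway Δ) = -(invAway Δ * invAway Δ) * pdAway Δ s (algebraMap (MvPolynomial σ ℂ) (Localization.Away Δ) Δ) := by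
  have h := congrArg (pdAway Δ s) (algebraMap_mul_invAway Δ)
  rw [Derivation.leibniz, Derivation.map_one_eq_zero, smul_eq_mul, smul_eq_mul] at h
  have h2 : pdAway Δ s (invAway Δ) = invAway Δ * (algebraMap (MvPolynomial σ ℂ) (Localization.Away Δ) Δ * pdAway Δ s (invAway Δ)) := by
    rw [← mul_assoc, mul_comm (invAway Δ), algebraMap_mul_invAway, one_mul]
  rw [h2, eq_neg_of_add_eq_zero_left h]
  ring

/-- `Δ(x)` is a unit of `ℂ` when nonzero (for the evaluation lift). [folklore] -/
theorem isUnit_aeval_self (x : σ → ℂ) (hx : MvPolynomial.aeval x Δ ≠ 0) : IsUnit ((MvPolynomial.aeval x).toRingHom Δ) := by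
  rw [AlgHom.toRingHom_eq_coe, RingHom.coe_coe]
  exact isUnit_iff_ne_zero.2 hx

/-- **EVALUATION `ev_x : 𝒜_Δ →ₐ[ℂ] ℂ` at a point `x` with `Δ(x) ≠ 0`** — `P·Δ^{−N} ↦ P(x)·Δ(x)^{−N}`. [LeeZhu1998, §5 p. 5032] -/
def evalAway (x : σ → ℂ) (hx : MvPolynomial.aeval x Δ ≠ 0) : Localization.Away Δ →ₐ[ℂ] ℂ :=
  { IsLocalization.Away.lift Δ (g := (MvPolynomial.aeval x).toRingHom) (isUnit_aeval_self Δ x hx) with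
    commutes' := fun c => by
      simp only [AlgHom.toRingHom_eq_coe, RingHom.toMonoidHom_eq_coe, OneHom.toFun_eq_coe, MonoidHom.toOneHom_coe, MonoidHom.coe_coe]
      rw [IsScalarTower.algebraMap_apply ℂ (MvPolynomial σ ℂ) (Localization.Away Δ), IsLocalization.Away.lift_eq, RingHom.coe_coe, AlgHom.commutes] }

/-- Evaluation on the image of a polynomial is polynomial evaluation. [LeeZhu1998, §5 p. 5032] -/
theorem evalAway_algebraMap (x : σ → ℂ) (hx : MvPolynomial.aeval x Δ ≠ 0) (P : MvPolynomial σ ℂ) :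
    evalAway Δ x hx (algebraMap (MvPolynomial σ ℂ) (Localization.Away Δ) P) = MvPolynomial.aeval x P :=
  IsLocalization.Away.lift_eq Δ (isUnit_aeval_self Δ x hx) P

/-- Evaluation of a coordinate. [LeeZhu1998, §5 p. 5032] -/
theorem evalAway_X (x : σ → ℂ) (hx : MvPolynomial.aeval x Δ ≠ 0) (t : σ) :
    evalAway Δ x hx (algebraMap (MvPolynomial σ ℂ) (Localization.Away Δ) (X t)) = x t := by
  rw [evalAway_algebraMap, MvPolynomial.aeval_X]

/-- Evaluation of `Δ⁻¹` is `Δ(x)⁻¹`. [LeeZhu1998, §5 p. 5032] -/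
theorem evalAway_invAway (x : σ → ℂ) (hx : MvPolynomial.aeval x Δ ≠ 0) : evalAway Δ x hx (invAway Δ) = (MvPolynomial.aeval x Δ)⁻¹ := by
  have h := congrArg (evalAway Δ x hx) (algebraMap_mul_invAway Δ)
  rw [map_mul, map_one, evalAway_algebraMap] at h
  exact eq_inv_of_mul_eq_one_right h

end Summit.HodgeConjecture.HodgeConjecture.Cruxes.HLiu418.K2LiuPolynomialLocalizationDerivationDefs

end
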